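import Summits.Langlands.Langlands.Theorems.SoloBlindLocalAgreement
import Summits.Langlands.Langlands.Theorems.SoloBlindWDClass
import Summits.Langlands.Langlands.Theorems.SoloBlindWDTransport
import Summits.Langlands.Langlands.Theorems.SoloBlindWDConj
import HarnessLib

/-!
# The summit's quantifier over reciprocity data is exactly local agreement (unconditional form)

With the three Weil–Deligne bookkeeping lemmas discharged (`SoloBlindWDConj`: WD-A,
`SoloBlindWDTransport`: WD-B, `SoloBlindWDClass`: WD-C), the results of `SoloBlindLocalAgreement`
become unconditional:

* `SoloBlind.recGL_eq_of_globalLanglands'` — reciprocity (`GlobalLanglandsCorrespondenceGLn n K`)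
  for two pinned data `𝓡`, `𝓡'` forces `rec_𝓡(π_v) = rec_𝓡'(π_v)` for every local component `π_v`
  of every L-algebraic cuspidal `π` of `GL_n(𝔸_K)`, at every finite place `v`;
* `SoloBlind.langlands_iff_one_datum'` —
  `Langlands ↔ ∀ F, Nonempty (ReciprocityData F) ∧ (local agreement, n ≥ 1) ∧
  (∀ n ≥ 1, ∀ hcpt, ∃ 𝓡₀, (A) in existence form for 𝓡₀ ∧ (B) for 𝓡₀)`.

So the summit as typed is equivalent to: non-vacuity of the pinned local data, reciprocity for a
single datum per `(F, n, hcpt)`, and the statement that ANY two pinned local Langlands data agree on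
cuspidal local components — in print a theorem (generic classes: Shalika 1974 with Henniart 1993),
in the tree open for `n ≥ 2`.

## References

* P. Deligne, Antwerp II, LNM 349 (1973), §8.4–8.6. [DeligneAntwerpII1973]
* D. Flath, Corvallis 1979, Thm. 3–4. [FlathCorvallis1979]
* G. Henniart, Invent. Math. 113 (1993). [Henniart1993]
* J. Shalika, Ann. of Math. 100 (1974), Thm. 5.5. [Shalika1974]
* K. Buzzard, T. Gee, LMS Lecture Notes 414 (2014), Conj. 3.2.1–3.2.2. [BuzzardGeeLMS2014]
-/

open scoped MatrixGroups Matrix Classical NumberField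
open NumberField IsDedekindDomain Filter Field
open Literature.NumberTheory.Automorphic Literature.NumberTheory.GaloisRepresentations

noncomputable section

namespace Summit.Langlands.Langlands.Theorems

namespace SoloBlind

variable {K : Type} [Field K] [NumberField K] {n : ℕ}

/-- **Reciprocity for two data forces local agreement on cuspidal local components**
(unconditional form of `recGL_eq_of_globalLanglands`). [cite: DeligneAntwerpII1973, §8.4.2]
[cite: FlathCorvallis1979, Thm. 3] [cite: BuzzardGeeLMS2014, Conj. 3.2.2] -/
theorem recGL_eq_of_globalLanglands' {𝓡 𝓡' : ReciprocityData K}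
    {hcpt : isCompact_glFiniteIntegralLevel n K}
    (h : GlobalLanglandsCorrespondenceGLn n K 𝓡 hcpt) (h' : GlobalLanglandsCorrespondenceGLn n K 𝓡' hcpt)
    (π : CuspidalAutomorphicRepData n K hcpt) (hπ : π.1.IsLAlgebraic) (v : HeightOneSpectrum (𝓞 K))
    (πv : SmoothIrrep (GL (Fin n) (v.adicCompletion K))) (hπv : π.1.HasLocalComponentAt v πv.ρ) :
    (𝓡.llc v).recGL n (IrrClass.mk πv) = (𝓡'.llc v).recGL n (IrrClass.mk πv) :=
  recGL_eq_of_globalLanglands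
    (fun _ _ _ ρW g r r' hr hr' ↦ wd_isEquivalent_of_isWeilDeligneOfLadic_conj ρW g r r' hr hr')
    (fun _ _ _ ι _ _ _ _ he ht ht' ↦ wd_isEquivalent_of_isTransportAlong (ι : _ →+* ℂ) he ht ht')
    (fun _ _ _ _ _ he hc hc' ↦ hasFrobSemisimpleClass_unique_of_isEquivalent he hc hc') h h' π hπ v πv hπv

/-- **`Langlands` ↔ non-vacuity ∧ local agreement ∧ one-datum reciprocity** (unconditional form of
`langlands_iff_one_datum`). [cite: Henniart1993, Thm. 1.1] [cite: Shalika1974, Thm. 5.5]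
[cite: BuzzardGeeLMS2014, Conj. 3.2.2] -/
theorem langlands_iff_one_datum' :
    Langlands ↔
      ∀ (F : Type) [Field F] [NumberField F],
        Nonempty (Summit.Langlands.ReciprocityData F) ∧
        (∀ (𝓡 𝓡' : Summit.Langlands.ReciprocityData F) (n : ℕ), 0 < n →
          ∀ (hcpt : isCompact_glFiniteIntegralLevel n F) (π : CuspidalAutomorphicRepData n F hcpt),
            π.1.IsLAlgebraic →
              ∀ (v : HeightOneSpectrum (𝓞 F)) (πv : SmoothIrrep (GL (Fin n) (v.adicCompletion F))),
                π.1.HasLocalComponentAt v πv.ρ →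
                  (𝓡.llc v).recGL n (IrrClass.mk πv) = (𝓡'.llc v).recGL n (IrrClass.mk πv)) ∧
        ∀ (n : ℕ), 0 < n → ∀ hcpt : isCompact_glFiniteIntegralLevel n F,
          ∃ 𝓡₀ : Summit.Langlands.ReciprocityData F,
            (∀ π : CuspidalAutomorphicRepData n F hcpt, π.1.IsLAlgebraic →
              ∀ (ℓ : ℕ) [Fact ℓ.Prime] (ι : PadicAlgCl ℓ ≃+* ℂ),
                ∃ ρ : FramedGaloisRep F (PadicAlgCl ℓ) n,
                  ρ.toGaloisRep.IsIrreducible ∧ IsGeometricFramed 𝓡₀ ρ ∧ Corresponds 𝓡₀ ι π.1 ρ) ∧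
            GaloisToAutomorphic n 𝓡₀ hcpt :=
  langlands_iff_one_datum
    (fun _ _ _ _ _ _ _ ρW g r r' hr hr' ↦ wd_isEquivalent_of_isWeilDeligneOfLadic_conj ρW g r r' hr hr')
    (fun _ _ _ _ _ _ _ ι _ _ _ _ he ht ht' ↦ wd_isEquivalent_of_isTransportAlong (ι : _ →+* ℂ) he ht ht')
    (fun _ _ _ _ _ _ _ _ _ he hc hc' ↦ hasFrobSemisimpleClass_unique_of_isEquivalent he hc hc')

/-- **Corollary: under `Langlands`, all pinned reciprocity data agree on cuspidal local
components.** [cite: BuzzardGeeLMS2014, Conj. 3.2.2] -/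
theorem recGL_eq_of_langlands (h : Langlands) (𝓡 𝓡' : ReciprocityData K) (hn : 0 < n)
    (hcpt : isCompact_glFiniteIntegralLevel n K) (π : CuspidalAutomorphicRepData n K hcpt)
    (hπ : π.1.IsLAlgebraic) (v : HeightOneSpectrum (𝓞 K))
    (πv : SmoothIrrep (GL (Fin n) (v.adicCompletion K))) (hπv : π.1.HasLocalComponentAt v πv.ρ) :
    (𝓡.llc v).recGL n (IrrClass.mk πv) = (𝓡'.llc v).recGL n (IrrClass.mk πv) :=
  recGL_eq_of_globalLanglands' ((h K).2 𝓡 n hn hcpt) ((h K).2 𝓡' n hn hcpt) π hπ v πv hπv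

end SoloBlind

end Summit.Langlands.Langlands.Theorems

end
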